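import Summits.BirchSwinnertonDyer.BirchSwinnertonDyer.Theorems.AlignedTransportAtTwoMainConjectureOfRankZeroBSDAtTwoSexticNormRelationDescentSignFreeMu
import HarnessLib

/-!
# Route `AlignedTransportAtTwo`, crux C2 `MainConjectureOfRankZeroBSDAtTwo` (stmt-BirchSwinnertonDyer-22298):
# THE `S₃` NORM-RELATION DESCENT AT `p = 2`, SIGN-FREE — part E: ONE ROOT SUFFICES — the three cubic towers have the same `e_n`,
# so `e_n(ℚ(W[2])) ≤ 3·e_n(ℚ(β)) + e_n(ℚ(√Δ_W))` and `μ₂(ℚ(W[2])) = 0 ⟸ μ₂(ℚ(β)) = 0 ∧ μ₂(ℚ(√Δ_W)) = 0` with a SINGLE `2`-torsion abscissa `β`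

Sequel of `…SexticNormRelationDescentSignFree{,Mu}` (same seat bsd-line-att-p4 g29). HONEST FRAMING: WIDTH-5 attached prover seat on line `birth` of the
lead `bsd-line-att-p2`; `--supports` stmt-BirchSwinnertonDyer-22298, closes nothing; BSD is NOT proved; crux C2, its verdict «blocked-on
`Rank1Residual.GreenbergMuConjectureIrreducible`» and every registered stub untouched. THEOREMS ONLY.

WHAT. `W/ℚ` elliptic with no rational `2`-torsion abscissa; `β₀, β₁, β₂ ∈ ℚ̄` the roots of the `2`-division cubic `f`. The three cubic fields `ℚ(β_j)` are
CONJUGATE: `minpoly_ℚ β_i = f/4` has `β_j` as a root (§1: `[ℚ(β_i):ℚ] = 3 = deg f`, so `f = 4·minpoly`), whence Mathlib's `minpoly.algEquiv` gives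
`ℚ(β_i) ≃ₐ[ℚ] ℚ(β_j)` (`nonempty_algEquiv_cubic`) and — transporting the restricted cyclotomic tower of `ℚ` along it (cell bsd-potss's
`classNumberPExp_restrict_eq_of_algEquiv`, normalisation-independence) — ★ `classNumberPExp_cubic_eq`: **`e_n(ℚ(β_i)) = e_n(ℚ(β_j))` for every `n`** and any
cyclotomic `ℤ₂`-extensions. Consequently parts B/C read with ONE cubic tower (`Δ_W ∉ ℚ²`, `2Δ_W ∉ ℚ²`, both signs):

* ★ `classNumberPExp_divisionField_two_le_three_mul_add` — **`e_n(ℚ(W[2])) ≤ 3·e_n(ℚ(β_j)) + e_n(ℚ(δ))`** (g28's part-1 title inequality, now a theorem for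
  both signs with a single root);
* ★ `classicalMuVanishes_divisionField_two_of_single_cubic_of_resolvent` — `μ₂(ℚ(β_j)) = 0` for ONE `j` (all cyclotomic towers of that one field) and
  `μ₂(ℚ(δ)) = 0` ⟹ `μ₂(ℚ(W[2])) = 0`; `classNumberPExp_divisionField_two_eq_zero_of_single_cubic_of_resolvent` (class-number form).

References: [Iwasawa1973MuInvariants] §3; [BiasseEtAl2022] Prop. 3.7; [Washington1997] §13.1; [MilneFT2022] Ch. 3; tree: parts A–B, Mathlib `minpoly.algEquiv`,
`ClassicalMuVanishesKleinDescent` (`classNumberPExp_restrict_eq_of_algEquiv`), `ClassicalMuVanishesNormRelationTower` (`classNumberPExp_eq_of_isCyclotomic`).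
-/

set_option linter.dupNamespace false
set_option autoImplicit false

noncomputable section

open scoped Classical NumberField

namespace Summit.BirchSwinnertonDyer.BirchSwinnertonDyer.Theorems.AlignedTransportAtTwoSexticNormRelationDescentSignFreeOneRoot

open NumberField Polynomial WeierstrassCurve IntermediateField Field
  Literature.NumberTheory.EllipticCurves Literature.NumberTheory.EllipticCurves.Greenberg1999
  Literature.NumberTheory.EllipticCurves.DokchitserDokchitser2012
  Literature.NumberTheory.EllipticCurves.ZpExtension Literature.NumberTheory.GaloisRepresentations
  Literature.NumberTheory.IwasawaTheory Literature.NumberTheory.NumberFields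
  Summit.BirchSwinnertonDyer.BirchSwinnertonDyer.Theorems.AlignedTransportAtTwoFineRoad.DivisionCubic
  Summit.BirchSwinnertonDyer.BirchSwinnertonDyer.Theorems.AlignedTransportAtTwoSexticNormRelationDescent
  Summit.BirchSwinnertonDyer.BirchSwinnertonDyer.Theorems.AlignedTransportAtTwoSexticNormRelationDescentMu
  Summit.BirchSwinnertonDyer.BirchSwinnertonDyer.Theorems.AlignedTransportAtTwoSexticNormRelationDescentSignFree
  Summit.BirchSwinnertonDyer.BirchSwinnertonDyer.Theorems.AlignedTransportAtTwoSexticNormRelationDescentSignFreeMu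

variable (W : WeierstrassCurve ℚ) [W.IsElliptic]

/-! ## §1 The three cubic fields are conjugate -/

/-- **`β_j` is a root of the minimal polynomial of `β_i`** (no rational `2`-torsion abscissa): `minpoly_ℚ β_i ∣ f` (the `2`-division cubic), both of
degree `3` (`[ℚ(β_i):ℚ] = 3`), so `f = c·minpoly_ℚ β_i` with `c ≠ 0`, and `f(β_j) = 0`. [cite: SilvermanAEC2009, III.§1] -/
theorem aeval_xT_minpoly_xT (ht : ∀ x : ℚ, ¬ HasRationalTwoTorsionX W x) (i j : Fin 3) :
    aeval (xT W two_ne_zero j) (minpoly ℚ (xT W two_ne_zero i)) = 0 := by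
  have h2 : (2 : ℚ) ≠ 0 := two_ne_zero
  set f : ℚ[X] := W.twoTorsionPolynomial.toPoly with hf
  have hf0 : f ≠ 0 := twoTorsionPolynomial_toPoly_ne_zero W h2
  have hi : aeval (xT W h2 i) f = 0 := (mem_rootSet_of_ne hf0).mp (xT_mem_rootSet W h2 i)
  have hj : aeval (xT W h2 j) f = 0 := (mem_rootSet_of_ne hf0).mp (xT_mem_rootSet W h2 j)
  have hint : IsIntegral ℚ (xT W h2 i) := ((AlgebraicClosure.isAlgebraic ℚ).isAlgebraic _).isIntegral
  -- degrees: `deg minpoly = [ℚ(β_i):ℚ] = 3 = deg f`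
  have hdegm : (minpoly ℚ (xT W h2 i)).natDegree = 3 := by
    rw [← IntermediateField.adjoin.finrank hint]
    have hirr := AlignedTransportAtTwoSeed.irr_two_of_forall_not_hasRationalTwoTorsionX W ht
    exact AddKatoTwo.finrank_adjoin_root_twoTorsionPolynomial_eq_three W hirr hi
  have hdegf : f.natDegree = 3 := Cubic.natDegree_of_a_ne_zero (by simp [WeierstrassCurve.twoTorsionPolynomial])
  -- `f = minpoly · q` with `q` a nonzero constant
  obtain ⟨q, hq⟩ := minpoly.dvd ℚ (xT W h2 i) hi
  have hq0 : q ≠ 0 := by rintro rfl; exact hf0 (by rw [hq, mul_zero])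
  have hm0 : minpoly ℚ (xT W h2 i) ≠ 0 := minpoly.ne_zero hint
  have hdq : q.natDegree = 0 := by
    have h := congrArg natDegree hq
    rw [natDegree_mul hm0 hq0, hdegf, hdegm] at h
    omega
  rw [Polynomial.eq_C_of_natDegree_eq_zero hdq] at hq
  have hc0 : q.coeff 0 ≠ 0 := by
    intro h0
    apply hq0
    rw [Polynomial.eq_C_of_natDegree_eq_zero hdq, h0, map_zero]
  have := hj
  rw [hq, map_mul, aeval_C, mul_eq_zero] at this
  rcases this with h | h
  · exact h
  · exact absurd ((map_eq_zero_iff _ (algebraMap ℚ (AlgebraicClosure ℚ)).injective).mp h) hc0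

/-- **`ℚ(β_i) ≃ ℚ(β_j)` over `ℚ`** (conjugate cubic fields: same minimal polynomial; Mathlib `minpoly.algEquiv`, sending `β_i ↦ β_j`).
[cite: MilneFT2022, Ch. 3] -/
theorem nonempty_algEquiv_cubic (ht : ∀ x : ℚ, ¬ HasRationalTwoTorsionX W x) (i j : Fin 3) :
    Nonempty (↥ℚ⟮xT W two_ne_zero i⟯ ≃ₐ[ℚ] ↥ℚ⟮xT W two_ne_zero j⟯) := by
  have hxi : IsAlgebraic ℚ (xT W two_ne_zero i) := (AlgebraicClosure.isAlgebraic ℚ).isAlgebraic _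
  exact ⟨minpoly.algEquiv hxi (minpoly.eq_of_root hxi (aeval_xT_minpoly_xT W ht i j)).symm⟩

/-- ★ **The three cubic towers have the same `2`-class numbers: `e_n(ℚ(β_i)) = e_n(ℚ(β_j))` for every `n`** (`κ_i`, `κ_j` any cyclotomic `ℤ₂`-extensions
of the conjugate cubic fields `ℚ(β_i)`, `ℚ(β_j) ⊆ ℚ̄`): both are `e_n` of the restriction of `ℚ`'s cyclotomic tower (`2 ∤ 3`), transported along §1's
isomorphism. [cite: Washington1997, §13.1] [cite: Iwasawa1973MuInvariants, §3] -/
theorem classNumberPExp_cubic_eq (ht : ∀ x : ℚ, ¬ HasRationalTwoTorsionX W x) (i j : Fin 3)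
    (κi : ZpExtension ↥ℚ⟮xT W two_ne_zero i⟯ 2) (hκi : κi.IsCyclotomic)
    (κj : ZpExtension ↥ℚ⟮xT W two_ne_zero j⟯ 2) (hκj : κj.IsCyclotomic) (n : ℕ) :
    classNumberPExp κi n = classNumberPExp κj n := by
  haveI : ∀ k : Fin 3, FiniteDimensional ℚ ↥ℚ⟮xT W two_ne_zero k⟯ := fun k ↦
    IntermediateField.adjoin.finiteDimensional ((AlgebraicClosure.isAlgebraic ℚ).isAlgebraic _).isIntegral
  haveI : ∀ k : Fin 3, NumberField ↥ℚ⟮xT W two_ne_zero k⟯ := fun k ↦ NumberField.mk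
  obtain ⟨κ, hκ⟩ := exists_cyclotomicZpExtension_holds ℚ 2
  obtain ⟨φ⟩ := nonempty_algEquiv_cubic W ht i j
  have hi := surjective_cubic_restrict W ht κ i
  have hj := surjective_cubic_restrict W ht κ j
  rw [classNumberPExp_eq_of_isCyclotomic κi (κ.restrict _ hi) hκi (isCyclotomic_restrict κ hκ _ hi) n,
    classNumberPExp_eq_of_isCyclotomic κj (κ.restrict _ hj) hκj (isCyclotomic_restrict κ hκ _ hj) n]
  exact classNumberPExp_restrict_eq_of_algEquiv κ φ hi hj n

/-- Hence **`μ₂ = 0` for one cubic tower gives it for all three** (growth form; all cyclotomic `ℤ₂`-extensions). [cite: Iwasawa1973MuInvariants, §3] -/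
theorem classicalMuVanishes_cubic_of_cubic (ht : ∀ x : ℚ, ¬ HasRationalTwoTorsionX W x) (i j : Fin 3)
    (κi : ZpExtension ↥ℚ⟮xT W two_ne_zero i⟯ 2) (hκi : κi.IsCyclotomic) (hμ : ClassicalMuVanishes κi)
    (κj : ZpExtension ↥ℚ⟮xT W two_ne_zero j⟯ 2) (hκj : κj.IsCyclotomic) : ClassicalMuVanishes κj := by
  obtain ⟨l, ν, n₀, h⟩ := hμ
  exact ⟨l, ν, n₀, fun n hn ↦ by rw [← classNumberPExp_cubic_eq W ht i j κi hκi κj hκj n]; exact h n hn⟩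

/-! ## §2 One root suffices in the descent -/

/-- ★ **`e_n(ℚ(W[2])) ≤ 3·e_n(ℚ(β_j)) + e_n(ℚ(δ))` for every `n`, BOTH signs of `Δ_W`** (`W` with no rational `2`-torsion abscissa, `Δ_W ∉ ℚ²`,
`2Δ_W ∉ ℚ²`; `κ_T, κ_j, κ_δ` any cyclotomic `ℤ₂`-extensions of `ℚ(W[2])`, of ONE cubic field `ℚ(β_j)`, of `ℚ(δ)`): part B's inequality with the three
cubic terms identified by §1. [cite: BiasseEtAl2022, Prop. 3.7] [cite: Washington1997, §13.1] -/
theorem classNumberPExp_divisionField_two_le_three_mul_add (ht : ∀ x : ℚ, ¬ HasRationalTwoTorsionX W x) (hsq : ¬ IsSquare W.Δ)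
    (h2Δ : ¬ IsSquare (2 * W.Δ)) (j : Fin 3) (κj : ZpExtension ↥ℚ⟮xT W two_ne_zero j⟯ 2) (hκj : κj.IsCyclotomic)
    (κk : ZpExtension ↥ℚ⟮4 * delta W two_ne_zero⟯ 2) (hκk : κk.IsCyclotomic)
    (κT : ZpExtension (W.divisionField 2) 2) (hκT : κT.IsCyclotomic) (n : ℕ) :
    classNumberPExp κT n ≤ 3 * classNumberPExp κj n + classNumberPExp κk n := by
  haveI : ∀ k : Fin 3, FiniteDimensional ℚ ↥ℚ⟮xT W two_ne_zero k⟯ := fun k ↦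
    IntermediateField.adjoin.finiteDimensional ((AlgebraicClosure.isAlgebraic ℚ).isAlgebraic _).isIntegral
  haveI : ∀ k : Fin 3, NumberField ↥ℚ⟮xT W two_ne_zero k⟯ := fun k ↦ NumberField.mk
  have hex : ∀ k : Fin 3, ∃ κk' : ZpExtension ↥ℚ⟮xT W two_ne_zero k⟯ 2, κk'.IsCyclotomic := fun k ↦ exists_cyclotomicZpExtension_holds _ 2
  choose κK hκK using hex
  have h := classNumberPExp_divisionField_two_le_sum W ht hsq h2Δ κK hκK κk hκk κT hκT n
  have hk : ∀ k : Fin 3, classNumberPExp (κK k) n = classNumberPExp κj n := fun k ↦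
    classNumberPExp_cubic_eq W ht k j (κK k) (hκK k) κj hκj n
  rw [Fin.sum_univ_three, hk 0, hk 1, hk 2] at h
  omega

/-- ★ **`μ₂(ℚ(β_j)^{cyc}) = 0` for ONE `2`-torsion abscissa and `μ₂(ℚ(δ)^{cyc}) = 0` ⟹ `μ₂(ℚ(W[2])^{cyc}) = 0`** (both signs of `Δ_W`; all cyclotomic
`ℤ₂`-extensions, growth form): part B's `μ`-form with §1 supplying the other two cubic towers. [cite: BiasseEtAl2022, Prop. 3.7] [cite: Iwasawa1973MuInvariants, §3] -/
theorem classicalMuVanishes_divisionField_two_of_single_cubic_of_resolvent (ht : ∀ x : ℚ, ¬ HasRationalTwoTorsionX W x)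
    (hsq : ¬ IsSquare W.Δ) (h2Δ : ¬ IsSquare (2 * W.Δ)) (j : Fin 3)
    (hj : ∀ κj : ZpExtension ↥ℚ⟮xT W two_ne_zero j⟯ 2, κj.IsCyclotomic → ClassicalMuVanishes κj)
    (hk : ∀ κk : ZpExtension ↥ℚ⟮4 * delta W two_ne_zero⟯ 2, κk.IsCyclotomic → ClassicalMuVanishes κk)
    (κT : ZpExtension (W.divisionField 2) 2) (hκT : κT.IsCyclotomic) : ClassicalMuVanishes κT := by
  haveI : ∀ k : Fin 3, FiniteDimensional ℚ ↥ℚ⟮xT W two_ne_zero k⟯ := fun k ↦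
    IntermediateField.adjoin.finiteDimensional ((AlgebraicClosure.isAlgebraic ℚ).isAlgebraic _).isIntegral
  haveI : ∀ k : Fin 3, NumberField ↥ℚ⟮xT W two_ne_zero k⟯ := fun k ↦ NumberField.mk
  obtain ⟨κj, hκj⟩ := exists_cyclotomicZpExtension_holds ↥ℚ⟮xT W two_ne_zero j⟯ 2
  refine classicalMuVanishes_divisionField_two_of_cubic_of_resolvent_of_not_isSquare W ht hsq h2Δ
    (fun i κi hκi ↦ classicalMuVanishes_cubic_of_cubic W ht j i κj hκj (hj κj hκj) κi hκi) hk κT hκT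

/-- **Class-number form with one root**: `2 ∤ h` along ONE cubic tower and along the resolvent tower ⟹ `2 ∤ h(ℚ(W[2])_n)` for every `n` (both signs).
[cite: BiasseEtAl2022, Prop. 3.7] [cite: Washington1997, §13.1] -/
theorem classNumberPExp_divisionField_two_eq_zero_of_single_cubic_of_resolvent (ht : ∀ x : ℚ, ¬ HasRationalTwoTorsionX W x)
    (hsq : ¬ IsSquare W.Δ) (h2Δ : ¬ IsSquare (2 * W.Δ)) (j : Fin 3)
    (hj : ∀ κj : ZpExtension ↥ℚ⟮xT W two_ne_zero j⟯ 2, κj.IsCyclotomic → ∀ n, classNumberPExp κj n = 0)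
    (hk : ∀ κk : ZpExtension ↥ℚ⟮4 * delta W two_ne_zero⟯ 2, κk.IsCyclotomic → ∀ n, classNumberPExp κk n = 0)
    (κT : ZpExtension (W.divisionField 2) 2) (hκT : κT.IsCyclotomic) (n : ℕ) : classNumberPExp κT n = 0 := by
  haveI : ∀ k : Fin 3, FiniteDimensional ℚ ↥ℚ⟮xT W two_ne_zero k⟯ := fun k ↦
    IntermediateField.adjoin.finiteDimensional ((AlgebraicClosure.isAlgebraic ℚ).isAlgebraic _).isIntegral
  haveI : ∀ k : Fin 3, NumberField ↥ℚ⟮xT W two_ne_zero k⟯ := fun k ↦ NumberField.mk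
  haveI : FiniteDimensional ℚ ↥ℚ⟮4 * delta W two_ne_zero⟯ :=
    IntermediateField.adjoin.finiteDimensional ((AlgebraicClosure.isAlgebraic ℚ).isAlgebraic _).isIntegral
  haveI : NumberField ↥ℚ⟮4 * delta W two_ne_zero⟯ := NumberField.mk
  obtain ⟨κj, hκj⟩ := exists_cyclotomicZpExtension_holds ↥ℚ⟮xT W two_ne_zero j⟯ 2
  obtain ⟨κk, hκk⟩ := exists_cyclotomicZpExtension_holds ↥ℚ⟮4 * delta W two_ne_zero⟯ 2
  have h := classNumberPExp_divisionField_two_le_three_mul_add W ht hsq h2Δ j κj hκj κk hκk κT hκT n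
  rw [hj κj hκj n, hk κk hκk n] at h
  omega

end Summit.BirchSwinnertonDyer.BirchSwinnertonDyer.Theorems.AlignedTransportAtTwoSexticNormRelationDescentSignFreeOneRoot

end
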